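import Summits.BirchSwinnertonDyer.BirchSwinnertonDyer.Theorems.SignedLowerHalvesSmallImageLowerHalfBothSignsRttOneSidedCruxTieredSupply
import Summits.BirchSwinnertonDyer.BirchSwinnertonDyer.Theorems.SignedLowerHalvesSmallImageLowerHalfBothSignsRttOneSidedCore
import Summits.BirchSwinnertonDyer.BirchSwinnertonDyer.Theorems.SignedLowerHalvesSmallImageLowerHalfBothSignsRttKanThetaLayerLambda
import HarnessLib

/-!
# Route `SignedLowerHalves`, crux L `SmallImageLowerHalfBothSigns` (item stmt-BirchSwinnertonDyer-23599), line `rtt_w3` v4: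
# TIER T1 IS CLOSED MODULO PRINT (+ the one-sign floor off `p = 3`) — crux L's body AT EVERY PAIR WITH A CM-CURVE PARTNER

LEAD `cruxlead-stmt-BirchSwinnertonDyer-23599` g2 (cell `bsd-ssimc`); helper `--supports stmt-BirchSwinnertonDyer-23599`; THEOREMS ONLY —
no definition, no named fact, no `sorry`. PER PAIR (the class-wide crux stays open on tier T2 and on the floor at `p ≥ 5`); BSD is proved
for no curve by this: every theorem below is CONDITIONAL on the displayed PUBLISHED named facts, and a pair needs its certificate
(`A`, a `Γ_ℚ`-equivariant `W[p] ≃ A[p]`).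

THE THEOREMS. Let `(W, p)` be a small-image supersingular X7 pair (`p` odd, `ClassX7 W p`, non-CM, `a_p = 0`, `¬ Surj W p`) and `A/ℚ` a
globally minimal CM elliptic curve, good supersingular at `p` with `a_p(A) = 0`, with `W[p] ≃ A[p]` `Γ_ℚ`-equivariantly (tier T1: 79 of
the 136 open census pairs — 57 at `p = 3` with `K = ℚ(i)`, 22 at `p = 5` with `K = ℚ(√−3)`). GRANTED BY NAME the print: Kobayashi 2003
(`hJ h12 h41`), the period units (`h5 h3`), Deligne/Carayol/Saito (`hD hC hS`), modularity (`hmod`), B. D. Kim 2009 Cor 2.13 (`hKim`),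
Pollack–Rubin 2004 (`hPR`), Vatsal 1999 (`hV`):
* `forall_kobayashiLowerDivisibility_three_of_cmCurvePartner` — at `p = 3`: `∀ ε, KobayashiLowerDivisibility W 3 ε` (crux L's body at the
  pair) with NO further input (the one-sign `μ`-floor at `3` is THEOREM B, input-free; Kan₂ is the landed p747435; ENG is the landed
  CM-curve engine p745857; K0₂ is not even needed — the partner is `f_A`).
* `forall_kobayashiLowerDivisibility_of_cmCurvePartner_of_oneSignFloor` — at `p ≥ 5`: the same from the one-sign floor AT THIS PAIR
  (`∃ ε₀ L₀, IsSignedPAdicLFunction f p ε₀ L₀ ∧ HasUnitContent L₀` for the newform `f` of `W`; certifiable per pair by orbit sums).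

References: [Kobayashi2003] Conjecture (p. 2), Thm. 1.2, 4.1, 7.4; [BDKim2009] Cor. 2.13; [PollackRubin2004] Theorem (p. 448); [Vatsal1999] (1.6), (1.13);
[KrausOesterle1992] §3 Prop. 3; [PollackWeston2011MT] §3.1, Thm. 4.1; [GreenbergVatsal2000] Prop. (2.4), §3 Rem. 3.4; [Pollack2003] Conj. 6.3, Prop. 6.18.
-/

set_option autoImplicit false
-- D-0017: single-problem summit, the namespace repeats the problem name by design.
set_option linter.dupNamespace false
noncomputable section

open scoped Classical MatrixGroups ModularForm BigOperators

open CongruenceSubgroup WeierstrassCurve Field Polynomial NumberField IsDedekindDomain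
  Literature.NumberTheory.EllipticCurves Literature.NumberTheory.EllipticCurves.ModularForms
  Literature.NumberTheory.EllipticCurves.Rank1Residual
  Literature.NumberTheory.EllipticCurves.Kobayashi2003
  Literature.NumberTheory.EllipticCurves.GreenbergVatsal2000 ZpExtension
  Literature.NumberTheory.IwasawaTheory Rat.HeightOneSpectrum
  Summit.BirchSwinnertonDyer.Rank1Residual.Supersingular
  Summit.BirchSwinnertonDyer.Rank1Residual.X1.MuLambda
  Summit.BirchSwinnertonDyer.BirchSwinnertonDyer.Theorems.SmallImageLambdaLowerThreeNsThetaTransport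

namespace Summit.BirchSwinnertonDyer.BirchSwinnertonDyer.Theorems.SmallImageRttOneSided

section TierOne

variable (W A : WeierstrassCurve ℚ) [W.IsElliptic] [W.IsGloballyMinimal] [A.IsElliptic] [A.IsGloballyMinimal]
  (p : ℕ) [Fact p.Prime]

/-- **The one-sided transport at a T1 pair, every sign, from print** (Kan₂ landed p747435 at the partner `f_A`; ENG = the landed
CM-curve engine p745857; supply p747597). CONDITIONAL on the displayed named facts; per pair.
[cite: Vatsal1999, Thm. (1.6), (1.13)] [cite: BDKim2009, Cor. 2.13] [cite: PollackRubin2004, Theorem (p. 448)] -/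
theorem lamTransport_le_of_cmCurvePartner
    (h12 : thm12_signedSelmerDual_finite_torsion)
    (h5 : realPeriodRat_eq_unit_mul_plusPeriod) (h3 : realPeriodRat_eq_unit_mul_plusPeriod_three)
    (hD : Hida2000_thm326_exists_galoisRep) (hC : Carayol1986_artinConductorExponent)
    (hS : ∀ (V : WeierstrassCurve ℚ) (ℓ : ℕ) [Fact ℓ.Prime],
      V.swanConductorAt_rationalTate_eq_wildConductorExponent_of_ringChar_eq_two ℓ)
    (hmod : exists_isNewformOf)
    (hKim : BDKim2009.cor213_signedLambda_add_sum_delta_eq_of_torsionIso)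
    (hPR : PollackRubin2004.mainTheorem_signedCharIdeal_eq_of_cm) (hV : vatsal1999_plusSymbol_congruence)
    (hp : p ≠ 2) (hX : ClassX7 W p) (hcm : ¬ W.HasCM) (hap : W.frobeniusTrace p = 0) (hs : ¬ Surj W p)
    (hcmA : A.HasCM) (hssA : GoodSS A p) (hapA : A.frobeniusTrace p = 0)
    (he : ∃ e : geomTorsion W (p : ℤ) ≃+ geomTorsion A (p : ℤ),
      ∀ (σ : absoluteGaloisGroup ℚ) (P : geomTorsion W (p : ℤ)), e (σ • P) = σ • e P) (ε : ℤˣ) :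
    ∀ (κ : ZpExtension ℚ p) (γ : absoluteGaloisGroup ℚ),
      κ.IsCyclotomic → κ.IsTopGenerator γ → IsCyclotomicVariable p γ →
      ∀ [NeZero (W.conductorNorm ℤ)] (f : CuspForm (Gamma0 (W.conductorNorm ℤ)) 2),
        IsNewformOf W f → ∀ (ϖ : ℚ), (ϖ : ℝ) * W.realPeriodRat = plusPeriod f →
      ∀ (Lplus Lminus : IwasawaAlgebra p), IsPollackPair f p Lplus Lminus →
        HasUnitContent (kobayashiL ε Lplus Lminus) →
      ∀ (D : SignedSelmerDualData W κ γ ε) [Module.Finite (IwasawaAlgebra p) D.X],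
        Module.IsTorsion (IwasawaAlgebra p) D.X → D.mu = 0 →
      ∀ (G : IwasawaAlgebra p) (m : ℕ),
        iwasawaToPowerSeries p G =
          PowerSeries.C ((p : ℚ_[p]) ^ m * (ϖ : ℚ_[p])) * iwasawaToPowerSeries p (kobayashiL ε Lplus Lminus) →
        lam G ≤ lambdaInvariant p D.X := by
  have hgood : W.HasGoodReductionAtPrime p := hX.1.1
  obtain ⟨iN, g, ι, Ω, hg, hpN, hlev, hnew, hcmg, hapg, hΩ, hcong, ⟨ϖA, hϖA⟩, hPol⟩ :=
    cmCurvePartner_supply hD hC hS hmod h5 h3 W A p hp hgood hcmA hssA hapA he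
  intro κ γ hκ hγ hγ' _ f hf ϖ hϖ Lplus Lminus hPP hfl D _ hXt hμ G m hG
  exact lamTransport_le_of_partner W p hp hgood ε g ι Ω hpN
    (Summit.BirchSwinnertonDyer.BirchSwinnertonDyer.Theorems.SmallImageRttKan.stub_thetaLayerLambda_ns hV W p hp hX hcm hap hs ε
      (A.conductorNorm ℤ) g ι Ω hpN hlev hnew hcmg hapg hΩ.isPlusPeriod hcong)
    (fun κ γ hκ hγ hγ' S₀ hS₀p hS₀W hS₀A D _ hXt hμ ↦
      partnerLayerLambdaLower_of_cmCurvePartner h12 hKim hPR W A p hp hgood hap hcmA hssA hapA he g hg ι Ω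
        hΩ.isPlusPeriod ϖA hϖA hPol ε κ γ hκ hγ hγ' S₀ hS₀p hS₀W hS₀A D hXt hμ)
    κ γ hκ hγ hγ' f hf ϖ hϖ Lplus Lminus hPP hfl D hXt hμ G m hG

/-- **TIER T1 AT `p = 3` IS CLOSED MODULO PRINT: crux L's body `∀ ε, KobayashiLowerDivisibility W 3 ε` at every small-image supersingular
X7 pair with a CM-CURVE partner** (`W[3] ≃ A[3]` `Γ_ℚ`-equivariantly, `A/ℚ` CM, good supersingular at `3`, `a_3(A) = 0`) — from the
displayed PUBLISHED named facts only (the one-sign `μ`-floor at `3` is THEOREM B, input-free: `…RttOneSidedCore` §3). Per pair;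
CONDITIONAL on print; the class-wide crux L / BSD are NOT proved by this.
[cite: Kobayashi2003, Conjecture (p. 2), Thm. 7.4 (p. 13)] [cite: BDKim2009, Cor. 2.13] [cite: PollackRubin2004, Theorem (p. 448)]
[cite: Vatsal1999, Thm. (1.6), (1.13)] [cite: Vaserstein1972SL2, Theorem] -/
theorem forall_kobayashiLowerDivisibility_three_of_cmCurvePartner (hp3 : p = 3)
    (hJ : thm62_63_73_signedColemanKato_zetaJoint) (h12 : thm12_signedSelmerDual_finite_torsion)
    (h41 : thm41_signedCharIdeal_divisibility)
    (h5 : realPeriodRat_eq_unit_mul_plusPeriod) (h3 : realPeriodRat_eq_unit_mul_plusPeriod_three)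
    (hD : Hida2000_thm326_exists_galoisRep) (hC : Carayol1986_artinConductorExponent)
    (hS : ∀ (V : WeierstrassCurve ℚ) (ℓ : ℕ) [Fact ℓ.Prime],
      V.swanConductorAt_rationalTate_eq_wildConductorExponent_of_ringChar_eq_two ℓ)
    (hmod : exists_isNewformOf)
    (hKim : BDKim2009.cor213_signedLambda_add_sum_delta_eq_of_torsionIso)
    (hPR : PollackRubin2004.mainTheorem_signedCharIdeal_eq_of_cm) (hV : vatsal1999_plusSymbol_congruence)
    (hX : ClassX7 W p) (hcm : ¬ W.HasCM) (hap : W.frobeniusTrace p = 0) (hs : ¬ Surj W p)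
    (hcmA : A.HasCM) (hssA : GoodSS A p) (hapA : A.frobeniusTrace p = 0)
    (he : ∃ e : geomTorsion W (p : ℤ) ≃+ geomTorsion A (p : ℤ),
      ∀ (σ : absoluteGaloisGroup ℚ) (P : geomTorsion W (p : ℤ)), e (σ • P) = σ • e P) :
    ∀ ε : ℤˣ, KobayashiLowerDivisibility W p ε := by
  have hp : p ≠ 2 := by omega
  exact forall_kobayashiLowerDivisibility_three_of_lamTransport_le W p hp3 hJ h12 h41 h5 h3 hX hap hs
    (fun ε κ γ hκ hγ hγ' _ f hf ϖ hϖ Lplus Lminus hPP hfl D _ hXt hμ G m hG ↦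
      lamTransport_le_of_cmCurvePartner W A p h12 h5 h3 hD hC hS hmod hKim hPR hV hp hX hcm hap hs hcmA hssA hapA he ε
        κ γ hκ hγ hγ' f hf ϖ hϖ Lplus Lminus hPP hfl D hXt hμ G m hG)

/-- **TIER T1 AT ANY ODD `p` MODULO PRINT AND THE ONE-SIGN FLOOR AT THE PAIR**: crux L's body `∀ ε, KobayashiLowerDivisibility W p ε`
at a small-image supersingular X7 pair with a CM-curve partner, from the displayed PUBLISHED named facts and ONE sign `ε₀` whose signed
`p`-adic `L`-function of `W` has unit content (for `p = 3` not needed: previous theorem; for `p ≥ 5` = `stub_muOneSign_ns_ge5` AT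
THIS PAIR, certifiable per pair by Teichmüller orbit sums). Per pair; CONDITIONAL; closes nothing class-wide.
[cite: Kobayashi2003, Conjecture (p. 2), Thm. 7.4 (p. 13)] [cite: Pollack2003, Conj. 6.3, Prop. 6.18] [cite: BDKim2009, Cor. 2.13]
[cite: PollackRubin2004, Theorem (p. 448)] -/
theorem forall_kobayashiLowerDivisibility_of_cmCurvePartner_of_oneSignFloor
    (hJ : thm62_63_73_signedColemanKato_zetaJoint) (h12 : thm12_signedSelmerDual_finite_torsion)
    (h41 : thm41_signedCharIdeal_divisibility)
    (h5 : realPeriodRat_eq_unit_mul_plusPeriod) (h3 : realPeriodRat_eq_unit_mul_plusPeriod_three)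
    (hD : Hida2000_thm326_exists_galoisRep) (hC : Carayol1986_artinConductorExponent)
    (hS : ∀ (V : WeierstrassCurve ℚ) (ℓ : ℕ) [Fact ℓ.Prime],
      V.swanConductorAt_rationalTate_eq_wildConductorExponent_of_ringChar_eq_two ℓ)
    (hmod : exists_isNewformOf)
    (hKim : BDKim2009.cor213_signedLambda_add_sum_delta_eq_of_torsionIso)
    (hPR : PollackRubin2004.mainTheorem_signedCharIdeal_eq_of_cm) (hV : vatsal1999_plusSymbol_congruence)
    (hp : p ≠ 2) (hX : ClassX7 W p) (hcm : ¬ W.HasCM) (hap : W.frobeniusTrace p = 0) (hs : ¬ Surj W p)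
    (hcmA : A.HasCM) (hssA : GoodSS A p) (hapA : A.frobeniusTrace p = 0)
    (he : ∃ e : geomTorsion W (p : ℤ) ≃+ geomTorsion A (p : ℤ),
      ∀ (σ : absoluteGaloisGroup ℚ) (P : geomTorsion W (p : ℤ)), e (σ • P) = σ • e P)
    (hfloor : ∀ [NeZero (W.conductorNorm ℤ)] (f : CuspForm (Gamma0 (W.conductorNorm ℤ)) 2), IsNewformOf W f →
      ∃ (ε₀ : ℤˣ) (L₀ : IwasawaAlgebra p), IsSignedPAdicLFunction f p ε₀ L₀ ∧ HasUnitContent L₀) :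
    ∀ ε : ℤˣ, KobayashiLowerDivisibility W p ε := by
  obtain ⟨ε₀, hε₀⟩ := LargeImageMuFloor.exists_sign_forall_isNewformOf (W := W)
    (fun ε f ↦ ∃ L₀ : IwasawaAlgebra p, IsSignedPAdicLFunction f p ε L₀ ∧ HasUnitContent L₀)
    (fun f hf ↦ hfloor f hf)
  have hfl : ∀ [NeZero (W.conductorNorm ℤ)] (f : CuspForm (Gamma0 (W.conductorNorm ℤ)) 2), IsNewformOf W f →
      ∀ Lplus Lminus : IwasawaAlgebra p, IsPollackPair f p Lplus Lminus →
        HasUnitContent (kobayashiL ε₀ Lplus Lminus) := by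
    intro _ f hf Lplus Lminus hPP
    obtain ⟨L₀, hL₀, hu⟩ := hε₀ f hf
    rwa [IsSignedPAdicLFunction.unique hL₀ (hPP.isSignedPAdicLFunction_kobayashiL ε₀)] at hu
  have hMC : KobayashiMainConjecture W p ε₀ :=
    kobayashiMainConjecture_of_lamTransport_le W p hp (thm62_63_73_signedColemanKato_zeta_of_joint hJ) h12 h41 h5 h3
      hX.1.1 hap hs ε₀ (fun f hf Lplus Lminus hPP ↦ hfl f hf Lplus Lminus hPP)
      (fun κ γ hκ hγ hγ' _ f hf ϖ hϖ Lplus Lminus hPP D _ hXt hμ G m hG ↦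
        lamTransport_le_of_cmCurvePartner W A p h12 h5 h3 hD hC hS hmod hKim hPR hV hp hX hcm hap hs hcmA hssA hapA he ε₀
          κ γ hκ hγ hγ' f hf ϖ hϖ Lplus Lminus hPP (hfl f hf Lplus Lminus hPP) D hXt hμ G m hG)
  exact fun ε ↦ (SignDefect.X7.exists_kobayashiLowerDivisibility_iff_forall W p h12 h5 h3 hJ hp hX hap).mp
    ⟨ε₀, kobayashiLowerDivisibility_of_mainConjecture hMC⟩ ε

end TierOne

end Summit.BirchSwinnertonDyer.BirchSwinnertonDyer.Theorems.SmallImageRttOneSided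

end
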